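import Summits.ResolutionOfSingularities.ResolutionOfSingularities.Theorems.PurelyInseparableDim4ResConeShearTransport
import HarnessLib
import HarnessLib.Audit.Tags

/-!
# Purely inseparable four-folds — FROBENIUS SHEAR RIGIDITY: a binary row of degree `p + 1` whose shear
# `x_{a′} ↦ x_{a′} + t x_a` has `x_{a′}`-adic order `≥ p` is `(x_{a′}^p − t^p x_a^p)·(λ x_a + μ x_{a′})`
# (K2(p) lane, SLICE C (C18): the (γ) lemma asked for by res-dim4-idea-4 g3 for E2 §D / R6, bus 2026-08-29T01:37:02Z;
# file-holder res-dim4-p-5 g3)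

[OURS · counted 0 · cell `res-dim4-pi` · K2(p) lane (desk WORDS #78 (d), #80 (d), #96 (b), #105 (d)) · seat p-5 g3.]
Nothing here proves K2(p), `NoIsolatedTrap p p` or resolution of singularities in dimension ≥ 4 / char. `p`.

Write `e j := x_a^{p+1−j} x_{a′}^j` (`Finsupp.single a (p + 1 - j) + Finsupp.single a' j`) for the monomials of the
`(a, a′)`-row of degree `p + 1`.
* `shear_frobenius_factor` — the freshman's dream under the shear: `shear a (t e_{a′}) (x_{a′}^p − t^p x_a^p) = x_{a′}^p`;
* `frobeniusRow_eq` — the rigid shape `(x_{a′}^p − t^p x_a^p)(λ x_a + μ x_{a′})` in monomials, and `coeff_frobeniusRow`;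
* `shear_frobeniusRow` — its shear is `x_{a′}^p ((λ + μ t) x_a + μ x_{a′})`, so `coeff_shear_frobeniusRow_eq_zero`:
  no row monomial `e j`, `j < p`, survives;
* **`row_eq_frobeniusRow_of_shear_order_ge`** — RIGIDITY: if `R` is supported on the row `{e j}` and the sheared row
  has no monomial `e j` with `j < p`, then `R = (x_{a′}^p − t^p x_a^p)(λ x_a + μ x_{a′})` with `λ = coeff_{e p} R`,
  `μ = coeff_{e (p+1)} R` (downward induction on the triangular system of `…ShearTransport.coeff_shear_single`;
  only `C(j, 0) = 1` is used — no Lucas); `coeff_row_of_shear_order_ge` reads off the four corner coefficients.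
[cite: Hauser2010, §I (definition of P⁺)] [cite: CossartJannsenSaito2020, Lemma 13.2, Thm. 13.7]
bears_on: LADDER-RESOLUTION:D157-DOOR2 (res-dim4-pi · K2(p) = `RidgeBudget.NoAboveFloorTrap p p` · slice C, lossy residual).
Supports stmt-ResolutionOfSingularities-16155 (helper).
-/

set_option linter.dupNamespace false -- mandated namespace of this single-conjunct summit

noncomputable section

namespace Summit.ResolutionOfSingularities.ResolutionOfSingularities.Theorems.PIDim4

namespace ResCone

open MvPolynomial Finset
open Literature.AlgebraicGeometry.Resolution
open Literature.AlgebraicGeometry.Resolution.Hauser2010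

variable {K : Type} [Field K]

section RowExponents

/-- The row monomial `e j = x_a^{n−j} x_{a′}^j` evaluated. [folklore] -/
theorem rowExp_apply {a a' : Fin 4} (haa : a ≠ a') (n j : ℕ) (i : Fin 4) :
    (Finsupp.single a (n - j) + Finsupp.single a' j : Fin 4 →₀ ℕ) i =
      if i = a then n - j else if i = a' then j else 0 := by
  rw [Finsupp.add_apply, Finsupp.single_apply, Finsupp.single_apply]
  by_cases hia : i = a
  · have h1 : a = i := hia.symm
    have h2 : ¬ a' = i := fun h => haa (h1.trans h.symm)
    rw [if_pos h1, if_neg h2, if_pos hia, add_zero]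
  · have h1 : ¬ a = i := fun h => hia h.symm
    rw [if_neg h1, if_neg hia, zero_add]
    by_cases hia' : i = a'
    · rw [if_pos hia'.symm, if_pos hia']
    · rw [if_neg (fun h => hia' h.symm), if_neg hia']

/-- Row monomials are distinguished by their `a′`-exponent. [folklore] -/
theorem rowExp_injective {a a' : Fin 4} (haa : a ≠ a') (n : ℕ) {j j' : ℕ}
    (h : (Finsupp.single a (n - j) + Finsupp.single a' j : Fin 4 →₀ ℕ) =
      Finsupp.single a (n - j') + Finsupp.single a' j') : j = j' := by
  have h1 : (Finsupp.single a (n - j) + Finsupp.single a' j : Fin 4 →₀ ℕ) a' =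
      (Finsupp.single a (n - j') + Finsupp.single a' j' : Fin 4 →₀ ℕ) a' := by rw [h]
  rw [rowExp_apply haa, rowExp_apply haa, if_neg haa.symm, if_pos rfl, if_neg haa.symm, if_pos rfl] at h1
  exact h1

/-- Equality tests against row monomials. [folklore] -/
theorem ite_rowExp {a a' : Fin 4} (haa : a ≠ a') (n k j : ℕ) (x : K) :
    (if (Finsupp.single a (n - k) + Finsupp.single a' k : Fin 4 →₀ ℕ) =
        Finsupp.single a (n - j) + Finsupp.single a' j then x else 0) = if j = k then x else 0 := by
  by_cases hjk : j = k
  · subst hjk; rw [if_pos rfl, if_pos rfl]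
  · rw [if_neg hjk, if_neg (fun h => hjk (rowExp_injective haa n h).symm)]

/-- The SOURCE of the `l`-th binomial term at a row monomial is the row monomial `l` places further:
`src (e j) l = e (j + l)` (in `ℕ`, for every `l`). [folklore] -/
theorem src_rowExp {a a' : Fin 4} (haa : a ≠ a') (n j l : ℕ) :
    (((Finsupp.single a (n - j) + Finsupp.single a' j : Fin 4 →₀ ℕ).update a
        ((Finsupp.single a (n - j) + Finsupp.single a' j : Fin 4 →₀ ℕ) a - l)).update a'
        ((Finsupp.single a (n - j) + Finsupp.single a' j : Fin 4 →₀ ℕ) a' + l)) =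
      Finsupp.single a (n - (j + l)) + Finsupp.single a' (j + l) := by
  have hva : (Finsupp.single a (n - j) + Finsupp.single a' j : Fin 4 →₀ ℕ) a = n - j := by
    rw [rowExp_apply haa, if_pos rfl]
  have hva' : (Finsupp.single a (n - j) + Finsupp.single a' j : Fin 4 →₀ ℕ) a' = j := by
    rw [rowExp_apply haa, if_neg haa.symm, if_pos rfl]
  ext i
  rw [shear_target_apply haa.symm, hva, hva', rowExp_apply haa, rowExp_apply haa]
  by_cases hia' : i = a'
  · have hia : ¬ i = a := fun h => haa (h.symm.trans hia')
    rw [if_pos hia', if_neg hia, if_pos hia']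
  · rw [if_neg hia', if_neg hia']
    by_cases hia : i = a
    · rw [if_pos hia, if_pos hia]; omega
    · rw [if_neg hia, if_neg hia, if_neg hia', if_neg hia]

end RowExponents

section Frobenius

variable (p : ℕ) [Fact p.Prime] [CharP K p]

/-- **The freshman's dream under the shear**: `shear a (t e_{a′}) (x_{a′}^p − t^p x_a^p) = x_{a′}^p`. [folklore] -/
theorem shear_frobenius_factor {a a' : Fin 4} (haa : a ≠ a') (t : K) :
    shear a (Pi.single a' t) ((X a' : MvPolynomial (Fin 4) K) ^ p - C (t ^ p) * X a ^ p) = X a' ^ p := by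
  have hXa : shear a (Pi.single a' t) (X a : MvPolynomial (Fin 4) K) = X a := shear_X_self a _
  have hXa' : shear a (Pi.single a' t) (X a' : MvPolynomial (Fin 4) K) = X a' + C t * X a := by
    rw [shear_X_of_ne haa.symm, Pi.single_eq_same]
  unfold shear at hXa hXa' ⊢
  have h2 : aeval (fun i => if i = a then (X a : MvPolynomial (Fin 4) K) else X i + C ((Pi.single a' t : Fin 4 → K) i) * X a)
      ((X a' : MvPolynomial (Fin 4) K) ^ p) = (X a' + C t * X a) ^ p := by rw [map_pow, hXa']
  have h3 : aeval (fun i => if i = a then (X a : MvPolynomial (Fin 4) K) else X i + C ((Pi.single a' t : Fin 4 → K) i) * X a)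
      ((X a : MvPolynomial (Fin 4) K) ^ p) = X a ^ p := by rw [map_pow, hXa]
  have h4 : aeval (fun i => if i = a then (X a : MvPolynomial (Fin 4) K) else X i + C ((Pi.single a' t : Fin 4 → K) i) * X a)
      (C (t ^ p) : MvPolynomial (Fin 4) K) = C (t ^ p) := by rw [aeval_C, algebraMap_eq]
  rw [map_sub, map_mul, h2, h3, h4, add_pow_char, mul_pow, ← C_pow]
  ring

omit [Fact p.Prime] [CharP K p] in
/-- The rigid row `(x_{a′}^p − t^p x_a^p)(λ x_a + μ x_{a′})` in monomials. [folklore] -/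
theorem frobeniusRow_eq (a a' : Fin 4) (t lam mu : K) :
    ((X a' : MvPolynomial (Fin 4) K) ^ p - C (t ^ p) * X a ^ p) * (C lam * X a + C mu * X a') =
      monomial (Finsupp.single a' p + Finsupp.single a 1) lam +
      monomial (Finsupp.single a' p + Finsupp.single a' 1) mu -
      (monomial (Finsupp.single a p + Finsupp.single a 1) (t ^ p * lam) +
        monomial (Finsupp.single a p + Finsupp.single a' 1) (t ^ p * mu)) := by
  rw [sub_mul, mul_add, mul_add, X_pow_eq_monomial, X_pow_eq_monomial, C_mul_X_eq_monomial, C_mul_X_eq_monomial,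
    C_mul_monomial, mul_one, monomial_mul, monomial_mul, monomial_mul, monomial_mul, one_mul, one_mul]

omit [Fact p.Prime] [CharP K p] in
/-- Coefficients of the rigid row at the row monomials `e j` (`p ≥ 2`). [folklore] -/
theorem coeff_frobeniusRow {a a' : Fin 4} (haa : a ≠ a') (t lam mu : K) (j : ℕ) :
    coeff (Finsupp.single a (p + 1 - j) + Finsupp.single a' j)
      (((X a' : MvPolynomial (Fin 4) K) ^ p - C (t ^ p) * X a ^ p) * (C lam * X a + C mu * X a')) =
      (if j = p then lam else 0) + (if j = p + 1 then mu else 0) -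
        ((if j = 0 then t ^ p * lam else 0) + (if j = 1 then t ^ p * mu else 0)) := by
  rw [frobeniusRow_eq, coeff_sub, coeff_add, coeff_add, coeff_monomial, coeff_monomial, coeff_monomial, coeff_monomial]
  -- identify the four exponents as row monomials
  have k1 : Finsupp.single a' p + Finsupp.single a 1 = Finsupp.single a (p + 1 - p) + Finsupp.single a' p := by
    rw [add_comm, Nat.add_sub_cancel_left]
  have k2 : Finsupp.single a' p + Finsupp.single a' 1 =
      Finsupp.single a (p + 1 - (p + 1)) + Finsupp.single a' (p + 1) := by
    rw [Nat.sub_self, Finsupp.single_zero, zero_add, Finsupp.single_add]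
  have k3 : Finsupp.single a p + Finsupp.single a 1 = Finsupp.single a (p + 1 - 0) + Finsupp.single a' 0 := by
    rw [Nat.sub_zero, Finsupp.single_zero, add_zero, Finsupp.single_add]
  have k4 : Finsupp.single a p + Finsupp.single a' 1 = Finsupp.single a (p + 1 - 1) + Finsupp.single a' 1 := by
    rw [Nat.add_sub_cancel]
  rw [k1, k2, k3, k4, ite_rowExp haa, ite_rowExp haa, ite_rowExp haa, ite_rowExp haa]

omit [Fact p.Prime] [CharP K p] in
/-- Off the row monomials `e j`, `j ≤ p + 1`, the rigid row has no coefficient. [folklore] -/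
theorem coeff_frobeniusRow_eq_zero (a a' : Fin 4) (t lam mu : K) {d : Fin 4 →₀ ℕ}
    (hd : ∀ j, j ≤ p + 1 → d ≠ Finsupp.single a (p + 1 - j) + Finsupp.single a' j) :
    coeff d (((X a' : MvPolynomial (Fin 4) K) ^ p - C (t ^ p) * X a ^ p) * (C lam * X a + C mu * X a')) = 0 := by
  rw [frobeniusRow_eq, coeff_sub, coeff_add, coeff_add, coeff_monomial, coeff_monomial, coeff_monomial, coeff_monomial]
  have k1 : Finsupp.single a' p + Finsupp.single a 1 = Finsupp.single a (p + 1 - p) + Finsupp.single a' p := by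
    rw [add_comm, Nat.add_sub_cancel_left]
  have k2 : Finsupp.single a' p + Finsupp.single a' 1 =
      Finsupp.single a (p + 1 - (p + 1)) + Finsupp.single a' (p + 1) := by
    rw [Nat.sub_self, Finsupp.single_zero, zero_add, Finsupp.single_add]
  have k3 : Finsupp.single a p + Finsupp.single a 1 = Finsupp.single a (p + 1 - 0) + Finsupp.single a' 0 := by
    rw [Nat.sub_zero, Finsupp.single_zero, add_zero, Finsupp.single_add]
  have k4 : Finsupp.single a p + Finsupp.single a' 1 = Finsupp.single a (p + 1 - 1) + Finsupp.single a' 1 := by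
    rw [Nat.add_sub_cancel]
  rw [k1, k2, k3, k4, if_neg (fun h => hd p (by omega) h.symm), if_neg (fun h => hd (p + 1) le_rfl h.symm),
    if_neg (fun h => hd 0 (by omega) h.symm), if_neg (fun h => hd 1 (by omega) h.symm)]
  ring

/-- **The sheared rigid row**: `shear (x_{a′}^p − t^p x_a^p)(λ x_a + μ x_{a′}) = x_{a′}^p((λ + μ t) x_a + μ x_{a′})`,
in monomials. [folklore] -/
theorem shear_frobeniusRow {a a' : Fin 4} (haa : a ≠ a') (t lam mu : K) :
    shear a (Pi.single a' t)
      (((X a' : MvPolynomial (Fin 4) K) ^ p - C (t ^ p) * X a ^ p) * (C lam * X a + C mu * X a')) =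
      monomial (Finsupp.single a' p + Finsupp.single a 1) (lam + mu * t) +
      monomial (Finsupp.single a' p + Finsupp.single a' 1) mu := by
  have h1 := shear_frobenius_factor p haa t
  have hXa : shear a (Pi.single a' t) (X a : MvPolynomial (Fin 4) K) = X a := shear_X_self a _
  have hXa' : shear a (Pi.single a' t) (X a' : MvPolynomial (Fin 4) K) = X a' + C t * X a := by
    rw [shear_X_of_ne haa.symm, Pi.single_eq_same]
  have hC : ∀ c : K, shear a (Pi.single a' t) (C c : MvPolynomial (Fin 4) K) = C c := fun c => by
    unfold shear; rw [aeval_C, algebraMap_eq]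
  unfold shear at h1 hXa hXa' hC ⊢
  rw [map_mul, h1, map_add, map_mul, map_mul, hC, hC, hXa, hXa']
  have : (X a' : MvPolynomial (Fin 4) K) ^ p * (C lam * X a + C mu * (X a' + C t * X a)) =
      X a' ^ p * (C (lam + mu * t) * X a) + X a' ^ p * (C mu * X a') := by
    rw [map_add, map_mul]; ring
  rw [this, X_pow_eq_monomial, C_mul_X_eq_monomial, C_mul_X_eq_monomial, monomial_mul, monomial_mul, one_mul, one_mul]

/-- Hence the sheared rigid row has NO row monomial `e j` with `j < p`. [folklore] -/
theorem coeff_shear_frobeniusRow_eq_zero {a a' : Fin 4} (haa : a ≠ a') (t lam mu : K) {j : ℕ} (hj : j < p) :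
    coeff (Finsupp.single a (p + 1 - j) + Finsupp.single a' j) (shear a (Pi.single a' t)
      (((X a' : MvPolynomial (Fin 4) K) ^ p - C (t ^ p) * X a ^ p) * (C lam * X a + C mu * X a'))) = 0 := by
  rw [shear_frobeniusRow p haa, coeff_add, coeff_monomial, coeff_monomial]
  have k1 : Finsupp.single a' p + Finsupp.single a 1 = Finsupp.single a (p + 1 - p) + Finsupp.single a' p := by
    rw [add_comm, Nat.add_sub_cancel_left]
  have k2 : Finsupp.single a' p + Finsupp.single a' 1 =
      Finsupp.single a (p + 1 - (p + 1)) + Finsupp.single a' (p + 1) := by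
    rw [Nat.sub_self, Finsupp.single_zero, zero_add, Finsupp.single_add]
  rw [k1, k2, if_neg (fun h => absurd (rowExp_injective haa (p + 1) h) (by omega)),
    if_neg (fun h => absurd (rowExp_injective haa (p + 1) h) (by omega)), add_zero]

/-- **FROBENIUS SHEAR RIGIDITY** (idea-4 E2 §D: «(y − tx)^p ∣ (C₀)_{p+1} ⇒ (C₀)_{p+1} = (y^p − t^p x^p)(λx + μy)»):
let `R` be supported on the `(a, a′)`-row of degree `p + 1` and suppose the sheared row `shear a (t e_{a′}) R` has no
monomial `x_a^{p+1−j} x_{a′}^j` with `j < p`.  Then `R = (x_{a′}^p − t^p x_a^p)(λ x_a + μ x_{a′})` with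
`λ = coeff_{x_a x_{a′}^p} R` and `μ = coeff_{x_{a′}^{p+1}} R`. [OURS] [cite: Hauser2010, §I (definition of P⁺)] -/
theorem row_eq_frobeniusRow_of_shear_order_ge {a a' : Fin 4} (haa : a ≠ a') (t : K) {R : MvPolynomial (Fin 4) K}
    (hrow : ∀ d ∈ R.support, ∃ j, j ≤ p + 1 ∧ d = Finsupp.single a (p + 1 - j) + Finsupp.single a' j)
    (hord : ∀ j, j < p →
      coeff (Finsupp.single a (p + 1 - j) + Finsupp.single a' j) (shear a (Pi.single a' t) R) = 0) :
    R = ((X a' : MvPolynomial (Fin 4) K) ^ p - C (t ^ p) * X a ^ p) *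
      (C (coeff (Finsupp.single a (p + 1 - p) + Finsupp.single a' p) R) * X a +
        C (coeff (Finsupp.single a (p + 1 - (p + 1)) + Finsupp.single a' (p + 1)) R) * X a') := by
  classical
  have hp2 : 2 ≤ p := (Fact.out : p.Prime).two_le
  set lam := coeff (Finsupp.single a (p + 1 - p) + Finsupp.single a' p) R with hlam
  set mu := coeff (Finsupp.single a (p + 1 - (p + 1)) + Finsupp.single a' (p + 1)) R with hmu
  set R₀ : MvPolynomial (Fin 4) K := ((X a' : MvPolynomial (Fin 4) K) ^ p - C (t ^ p) * X a ^ p) *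
    (C lam * X a + C mu * X a') with hR₀
  set D := R - R₀ with hD
  -- the difference solves the homogeneous triangular system with zero top data
  have hDord : ∀ j, j < p →
      coeff (Finsupp.single a (p + 1 - j) + Finsupp.single a' j) (shear a (Pi.single a' t) D) = 0 := by
    intro j hj
    have : shear a (Pi.single a' t) D = shear a (Pi.single a' t) R - shear a (Pi.single a' t) R₀ := by
      rw [hD]; unfold shear; rw [map_sub]
    rw [this, coeff_sub, hord j hj, hR₀, coeff_shear_frobeniusRow_eq_zero p haa t lam mu hj, sub_zero]
  have hDp : coeff (Finsupp.single a (p + 1 - p) + Finsupp.single a' p) D = 0 := by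
    rw [hD, coeff_sub, hR₀, coeff_frobeniusRow p haa, if_pos rfl, if_neg (by omega), if_neg (by omega),
      if_neg (by omega), ← hlam]
    ring
  have hDp1 : coeff (Finsupp.single a (p + 1 - (p + 1)) + Finsupp.single a' (p + 1)) D = 0 := by
    rw [hD, coeff_sub, hR₀, coeff_frobeniusRow p haa, if_neg (by omega), if_pos rfl, if_neg (by omega),
      if_neg (by omega), ← hmu]
    ring
  -- downward induction on the row
  have hDrow : ∀ n, ∀ j, p + 1 - n ≤ j → j ≤ p + 1 →
      coeff (Finsupp.single a (p + 1 - j) + Finsupp.single a' j) D = 0 := by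
    intro n
    induction n with
    | zero =>
      intro j h1 h2
      obtain rfl : j = p + 1 := by omega
      exact hDp1
    | succ n ih =>
      intro j h1 h2
      by_cases hj : p + 1 - n ≤ j
      · exact ih j hj h2
      by_cases hjp : j = p
      · rw [hjp]; exact hDp
      by_cases hjp1 : j = p + 1
      · rw [hjp1]; exact hDp1
      have hjlt : j < p := by omega
      have hEq := hDord j hjlt
      rw [coeff_shear_single haa] at hEq
      have hva : (Finsupp.single a (p + 1 - j) + Finsupp.single a' j : Fin 4 →₀ ℕ) a = p + 1 - j := by
        rw [rowExp_apply haa, if_pos rfl]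
      rw [Finset.sum_range_succ'] at hEq
      have hzero : ∑ l ∈ Finset.range ((Finsupp.single a (p + 1 - j) + Finsupp.single a' j : Fin 4 →₀ ℕ) a),
          (((Finsupp.single a (p + 1 - j) + Finsupp.single a' j : Fin 4 →₀ ℕ) a' + (l + 1)).choose (l + 1) : K) *
            t ^ (l + 1) *
            coeff (((Finsupp.single a (p + 1 - j) + Finsupp.single a' j : Fin 4 →₀ ℕ).update a
              ((Finsupp.single a (p + 1 - j) + Finsupp.single a' j : Fin 4 →₀ ℕ) a - (l + 1))).update a'
              ((Finsupp.single a (p + 1 - j) + Finsupp.single a' j : Fin 4 →₀ ℕ) a' + (l + 1))) D = 0 := by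
        refine Finset.sum_eq_zero fun l hl => ?_
        have hl' := Finset.mem_range.mp hl
        rw [hva] at hl'
        rw [src_rowExp haa, ih (j + (l + 1)) (by omega) (by omega), mul_zero]
      rw [hzero, zero_add, src_rowExp haa, Nat.add_zero, Nat.choose_zero_right,
        Nat.cast_one, pow_zero, one_mul, one_mul] at hEq
      exact hEq
  have hDzero : D = 0 := by
    ext d
    rw [coeff_zero]
    by_cases hd : ∃ j, j ≤ p + 1 ∧ d = Finsupp.single a (p + 1 - j) + Finsupp.single a' j
    · obtain ⟨j, hj, rfl⟩ := hd
      exact hDrow (p + 1) j (by omega) hj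
    · push Not at hd
      have hR : coeff d R = 0 := by
        by_contra h
        obtain ⟨j, hj, hdj⟩ := hrow d (MvPolynomial.mem_support_iff.mpr h)
        exact hd j hj hdj
      rw [hD, coeff_sub, hR, hR₀, coeff_frobeniusRow_eq_zero p a a' t lam mu hd, sub_zero]
  rw [← sub_eq_zero, ← hD, hDzero]

/-- Hence the four corner coefficients determine the row: `coeff_{e j} R = [j = p]·λ + [j = p+1]·μ − [j = 0]·t^p λ −
[j = 1]·t^p μ` with `λ = coeff_{e p} R`, `μ = coeff_{e (p+1)} R`; in particular `coeff_{e j} R = 0` for `2 ≤ j ≤ p − 1`.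
[OURS] [cite: Hauser2010, §I (definition of P⁺)] -/
theorem coeff_row_of_shear_order_ge {a a' : Fin 4} (haa : a ≠ a') (t : K) {R : MvPolynomial (Fin 4) K}
    (hrow : ∀ d ∈ R.support, ∃ j, j ≤ p + 1 ∧ d = Finsupp.single a (p + 1 - j) + Finsupp.single a' j)
    (hord : ∀ j, j < p →
      coeff (Finsupp.single a (p + 1 - j) + Finsupp.single a' j) (shear a (Pi.single a' t) R) = 0)
    (j : ℕ) :
    coeff (Finsupp.single a (p + 1 - j) + Finsupp.single a' j) R =
      (if j = p then coeff (Finsupp.single a (p + 1 - p) + Finsupp.single a' p) R else 0) +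
      (if j = p + 1 then coeff (Finsupp.single a (p + 1 - (p + 1)) + Finsupp.single a' (p + 1)) R else 0) -
      ((if j = 0 then t ^ p * coeff (Finsupp.single a (p + 1 - p) + Finsupp.single a' p) R else 0) +
        (if j = 1 then t ^ p * coeff (Finsupp.single a (p + 1 - (p + 1)) + Finsupp.single a' (p + 1)) R else 0)) := by
  have hp2 : 2 ≤ p := (Fact.out : p.Prime).two_le
  have hR := row_eq_frobeniusRow_of_shear_order_ge p haa t hrow hord
  conv_lhs => rw [hR]
  rw [coeff_frobeniusRow p haa]

end Frobenius

end ResCone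

end Summit.ResolutionOfSingularities.ResolutionOfSingularities.Theorems.PIDim4

end
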